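import Literature.Analysis.FluidPDE.NovackScalingLaws
import HarnessLib

/-!
# Novack's transverse (`8/15`-type) law from the 4/3 and 4/5 lines (Novack 2024, Thm. 1, proofs)

Topic: Analysis/FluidPDE, proofs about the named facts of
`Literature.Analysis.FluidPDE.NovackScalingLaws` (Novack 2024, Thm. 1, Euler case).

## Main result

`Torus.novack2024_transverseLaw_of_fourThirds_fourFifths :
  novack2024_fourThirds_fourFifths → novack2024_transverseLaw` — the transverse line `• = T` of
Novack's Theorem 1 follows from the lines `• = I, L` **exactly as in the printed proof**
(Novack 2024, §2, Step 2, last paragraph: "In order to prove (1.6c), we use that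
`|T_I v|² = |T_L v|² + |T_T v|²` for any vector `v`"): on the unit sphere
`(δu·ω) |δu − (δu·ω)ω|² = (δu·ω)|δu|² − (δu·ω)³`, so for every scale `ℓ` the transverse shell
pairing is the energy-flux pairing minus the longitudinal one
(`Torus.integral_mixedFlux_eq_sub`, Fubini on `((0,T) × T^d) × S^{d-1}` for `u ∈ L³`), and the
limits subtract: `−(4/d) D ψ + (12/(d(d+2))) D ψ = −(4(d−1)/(d(d+2))) D ψ` (`= −(8/15) D ψ` in
`d = 3`, Remark 1).

Hence the discharge of `novack2024_transverseLaw` is reduced to that of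
`novack2024_fourThirds_fourFifths` (Thm. 1, lines `I`, `L`: the ball-kernel Duchon–Robert balance
for weak solutions, §2 Steps 0–2), which is the substantial part of the source and is tracked
separately.

## References

* M. Novack, *Scaling laws and exact results in turbulence*, Nonlinearity 37 (2024) 095002,
  arXiv:2310.01375, Thm. 1 (1.6a–c), Remark 1, §2 Step 2 (last paragraph). [Novack2024]
* G. L. Eyink, *Local 4/5-law and energy dissipation anomaly in turbulence*, Nonlinearity 16
  (2003) 137–145, proof of Thm. 1 (`u_L + u_T = u`, Pythagoras). [Eyink2003]
-/

noncomputable section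

open MeasureTheory MeasureTheory.Measure TopologicalSpace Set Function Filter Metric
open _root_.Topology
open scoped InnerProductSpace RealInnerProductSpace ENNReal NNReal

namespace Literature.Analysis.FluidPDE.Torus

variable {d : Type*} [Fintype d]

/-! ## Pythagoras for the cubic forms on the unit sphere -/

/-- **`|T_I v|² = |T_L v|² + |T_T v|²` in cubic-form guise**: for a unit vector `ω`,
`⟪v, ω⟫ |v − ⟪v, ω⟫ ω|² = ⟪v, ω⟫ |v|² − ⟪v, ω⟫³` (Novack 2024, §2 Step 2, last paragraph;
Eyink 2003, proof of Thm. 1). [cite: Novack2024, Sect. 2 Step 2] -/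
theorem cubicFormT_eq_sub (v : EuclideanSpace ℝ d) {ω : EuclideanSpace ℝ d} (hω : ‖ω‖ = 1) :
    ⟪v, ω⟫ * ‖v - ⟪v, ω⟫ • ω‖ ^ 2 = ⟪v, ω⟫ * ‖v‖ ^ 2 - ⟪v, ω⟫ ^ 3 := by
  have h : ‖v - ⟪v, ω⟫ • ω‖ ^ 2 = ‖v‖ ^ 2 - ⟪v, ω⟫ ^ 2 := by
    rw [norm_sub_sq_real, inner_smul_right, norm_smul, Real.norm_eq_abs, hω, mul_one, sq_abs]
    ring
  rw [h]
  ring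

/-- The cubic form `Q_I(ω, v) = ⟪v, ω⟫ |v|²` of the energy flux is continuous. [folklore] -/
theorem continuous_cubicFormI :
    Continuous (uncurry fun (ω v : EuclideanSpace ℝ d) => ⟪v, ω⟫ * ‖v‖ ^ 2) :=
  (continuous_snd.inner continuous_fst).mul (continuous_snd.norm.pow 2)

/-- `|⟪v, ω⟫| |v|² ≤ |v|³` for `|ω| ≤ 1`. [folklore] -/
theorem abs_cubicFormI_le {ω : EuclideanSpace ℝ d} (v : EuclideanSpace ℝ d) (hω : ‖ω‖ ≤ 1) :
    |⟪v, ω⟫ * ‖v‖ ^ 2| ≤ 1 * ‖v‖ ^ 3 := by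
  rw [one_mul, abs_mul, abs_of_nonneg (pow_nonneg (norm_nonneg v) 2)]
  calc |⟪v, ω⟫| * ‖v‖ ^ 2 ≤ ‖v‖ * ‖ω‖ * ‖v‖ ^ 2 := by
        gcongr; exact abs_real_inner_le_norm v ω
    _ ≤ ‖v‖ * 1 * ‖v‖ ^ 2 := by gcongr
    _ = ‖v‖ ^ 3 := by ring

/-! ## Shell pairings on the product `((0,T) × T^d) × S^{d-1}` -/

section Shell

variable {T : ℝ} {u : ℝ → UnitAddTorus d → EuclideanSpace ℝ d} {ψ : ℝ → UnitAddTorus d → ℝ}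
  {Q : EuclideanSpace ℝ d → EuclideanSpace ℝ d → ℝ} {Cψ : ℝ}

/-- **Shell pairings in full product form**: if `((t,x), ω) ↦ Q(ω, δu(t,x; rω)) ψ(t,x)` is
integrable on `((0,T) × T^d) × S^{d-1}`, then
`∫_{(0,T)×T^d} ⨍ Q(ω, δu(·; rω)) dω ψ = |S^{d-1}|⁻¹ ∫_{((0,T)×T^d)×S^{d-1}} Q(ω, δu(t,x; rω)) ψ(t,x)`
(Fubini). [folklore] -/
theorem integral_sphereAvg_mul_eq_integral_prod [Nonempty d] {r : ℝ}
    (hF : Integrable (fun q : (ℝ × UnitAddTorus d) × sphere (0 : EuclideanSpace ℝ d) 1 =>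
        Q (q.2 : EuclideanSpace ℝ d) (increment (u q.1.1) (r • (q.2 : EuclideanSpace ℝ d)) q.1.2) *
          ψ q.1.1 q.1.2)
      (((volume.restrict (Ioo 0 T)).prod volume).prod volume.toSphere)) :
    ∫ p, sphereAvg (fun y => Q y (increment (u p.1) (r • y) p.2)) * ψ p.1 p.2
        ∂((volume.restrict (Ioo 0 T)).prod volume) =
      ((volume : Measure (EuclideanSpace ℝ d)).toSphere.real univ)⁻¹ *
        ∫ q : (ℝ × UnitAddTorus d) × sphere (0 : EuclideanSpace ℝ d) 1,
          Q (q.2 : EuclideanSpace ℝ d) (increment (u q.1.1) (r • (q.2 : EuclideanSpace ℝ d)) q.1.2) *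
            ψ q.1.1 q.1.2 ∂(((volume.restrict (Ioo 0 T)).prod volume).prod volume.toSphere) := by
  have hc := (toSphere_real_univ_pos (d := d)).ne'
  have h2 : ∀ p : ℝ × UnitAddTorus d,
      ∫ ω : sphere (0 : EuclideanSpace ℝ d) 1,
          Q (ω : EuclideanSpace ℝ d) (increment (u p.1) (r • (ω : EuclideanSpace ℝ d)) p.2) * ψ p.1 p.2
            ∂volume.toSphere =
        (volume : Measure (EuclideanSpace ℝ d)).toSphere.real univ *
          (sphereAvg (fun y => Q y (increment (u p.1) (r • y) p.2)) * ψ p.1 p.2) := fun p => by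
    rw [integral_mul_const,
      integral_sphere_eq_mul_sphereAvg (fun y => Q y (increment (u p.1) (r • y) p.2)), mul_assoc]
  rw [integral_prod _ hF]
  have h3 : (fun p : ℝ × UnitAddTorus d => ∫ ω : sphere (0 : EuclideanSpace ℝ d) 1,
        Q (ω : EuclideanSpace ℝ d) (increment (u p.1) (r • (ω : EuclideanSpace ℝ d)) p.2) * ψ p.1 p.2
          ∂volume.toSphere) =
      fun p => (volume : Measure (EuclideanSpace ℝ d)).toSphere.real univ *
        (sphereAvg (fun y => Q y (increment (u p.1) (r • y) p.2)) * ψ p.1 p.2) := funext h2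
  simp only [h3]
  rw [integral_const_mul, ← mul_assoc, inv_mul_cancel₀ hc, one_mul]

/-- **The transverse shell pairing is the energy-flux pairing minus the longitudinal one**
(Novack 2024, §2 Step 2, last paragraph, `|T_I v|² = |T_L v|² + |T_T v|²`): for `u ∈ L³((0,T) × T^d)`
jointly measurable, `ψ` bounded measurable and every scale `ℓ`,
`∫₀ᵀ∫ ℓ⁻¹ ⨍ δ_L u |δu_T|²(ℓω) dω ψ = ∫₀ᵀ∫ ℓ⁻¹ ⨍ δ_L u |δu|²(ℓω) dω ψ − ∫₀ᵀ∫ ℓ⁻¹ ⨍ (δ_L u)³(ℓω) dω ψ`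
(all three pairings are honest integrals, `Torus.integrable_sphere_increment`). [cite: Novack2024, Sect. 2 Step 2] -/
theorem integral_mixedFlux_eq_sub [Nonempty d]
    (hu : AEStronglyMeasurable (uncurry u) ((volume.restrict (Ioo 0 T)).prod volume))
    (hu3 : ∫⁻ p, ‖uncurry u p‖ₑ ^ 3 ∂((volume.restrict (Ioo 0 T)).prod volume) < ∞)
    (hψm : AEStronglyMeasurable (uncurry ψ) ((volume.restrict (Ioo 0 T)).prod volume))
    (hψb : ∀ t x, |ψ t x| ≤ Cψ) (ℓ : ℝ) :
    ∫ t in Ioo 0 T, ∫ x, ℓ⁻¹ * mixedFluxSphereAvg (u t) ℓ x * ψ t x =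
      (∫ t in Ioo 0 T, ∫ x, ℓ⁻¹ * energyFluxSphereAvg (u t) ℓ x * ψ t x) -
        ∫ t in Ioo 0 T, ∫ x, ℓ⁻¹ * longitudinalFluxSphereAvg (u t) ℓ x * ψ t x := by
  set μp : Measure (ℝ × UnitAddTorus d) := (volume.restrict (Ioo 0 T)).prod volume with hμp
  -- the three cubic forms and their bounds
  set QI : EuclideanSpace ℝ d → EuclideanSpace ℝ d → ℝ := fun ω v => ⟪v, ω⟫ * ‖v‖ ^ 2 with hQI
  set QL : EuclideanSpace ℝ d → EuclideanSpace ℝ d → ℝ := fun ω v => ⟪v, ω⟫ ^ 3 with hQL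
  set QT : EuclideanSpace ℝ d → EuclideanSpace ℝ d → ℝ :=
    fun ω v => ⟪v, ω⟫ * ‖v - ⟪v, ω⟫ • ω‖ ^ 2 with hQT
  have hQIc : Continuous (uncurry QI) := continuous_cubicFormI
  have hQIb : ∀ ω v, ‖ω‖ ≤ 1 → |QI ω v| ≤ 1 * ‖v‖ ^ 3 := fun ω v hω => abs_cubicFormI_le v hω
  have hQLc : Continuous (uncurry QL) := continuous_cubicFormL
  have hQLb : ∀ ω v, ‖ω‖ ≤ 1 → |QL ω v| ≤ 1 * ‖v‖ ^ 3 := fun ω v hω => abs_cubicFormL_le v hω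
  have hQTc : Continuous (uncurry QT) := continuous_cubicFormT
  have hQTb : ∀ ω v, ‖ω‖ ≤ 1 → |QT ω v| ≤ 4 * ‖v‖ ^ 3 := fun ω v hω => abs_cubicFormT_le v hω
  have h4 : (0 : ℝ) ≤ 4 := by norm_num
  -- iterated integrals in product form
  have eT : ∫ t in Ioo 0 T, ∫ x, ℓ⁻¹ * mixedFluxSphereAvg (u t) ℓ x * ψ t x =
      ℓ⁻¹ * ∫ p, mixedFluxSphereAvg (u p.1) ℓ p.2 * ψ p.1 p.2 ∂μp :=
    integral_integral_sphereAvg_eq hu hu3 hψm hψb hQTc h4 hQTb ℓ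
  have eI : ∫ t in Ioo 0 T, ∫ x, ℓ⁻¹ * energyFluxSphereAvg (u t) ℓ x * ψ t x =
      ℓ⁻¹ * ∫ p, energyFluxSphereAvg (u p.1) ℓ p.2 * ψ p.1 p.2 ∂μp :=
    integral_integral_sphereAvg_eq hu hu3 hψm hψb hQIc zero_le_one hQIb ℓ
  have eL : ∫ t in Ioo 0 T, ∫ x, ℓ⁻¹ * longitudinalFluxSphereAvg (u t) ℓ x * ψ t x =
      ℓ⁻¹ * ∫ p, longitudinalFluxSphereAvg (u p.1) ℓ p.2 * ψ p.1 p.2 ∂μp :=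
    integral_integral_sphereAvg_eq hu hu3 hψm hψb hQLc zero_le_one hQLb ℓ
  rw [eT, eI, eL, ← mul_sub]
  congr 1
  -- full product form on `((0,T) × T^d) × S^{d-1}`
  have hFT := integrable_sphere_increment hu hu3 hψm hψb hQTc h4 hQTb ℓ
  have hFI := integrable_sphere_increment hu hu3 hψm hψb hQIc zero_le_one hQIb ℓ
  have hFL := integrable_sphere_increment hu hu3 hψm hψb hQLc zero_le_one hQLb ℓ
  have pT : ∫ p, mixedFluxSphereAvg (u p.1) ℓ p.2 * ψ p.1 p.2 ∂μp = _ :=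
    integral_sphereAvg_mul_eq_integral_prod hFT
  have pI : ∫ p, energyFluxSphereAvg (u p.1) ℓ p.2 * ψ p.1 p.2 ∂μp = _ :=
    integral_sphereAvg_mul_eq_integral_prod hFI
  have pL : ∫ p, longitudinalFluxSphereAvg (u p.1) ℓ p.2 * ψ p.1 p.2 ∂μp = _ :=
    integral_sphereAvg_mul_eq_integral_prod hFL
  rw [pT, pI, pL, ← mul_sub, ← integral_sub hFI hFL]
  congr 1
  refine integral_congr_ae (ae_of_all _ fun q => ?_)
  simp only [hQT, hQI, hQL]
  rw [cubicFormT_eq_sub _ (norm_eq_of_mem_sphere q.2), sub_mul]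

end Shell

/-! ## The transverse line from the lines `I`, `L` -/

/-- The constant bookkeeping of Novack 2024, §2 Step 2 (last display): for `d ≠ 0`,
`−(4/d) c − (−(12/(d(d+2))) c) = −(4(d−1)/(d(d+2))) c`. [cite: Novack2024, Sect. 2 Step 2] -/
theorem neg_fourThirdsConst_mul_sub (hd : Fintype.card d ≠ 0) (c : ℝ) :
    -fourThirdsConst d * c - -fourFifthsConst d * c =
      -(4 * ((Fintype.card d : ℝ) - 1) / ((Fintype.card d : ℝ) * ((Fintype.card d : ℝ) + 2))) * c := by
  have hd0 : (Fintype.card d : ℝ) ≠ 0 := by exact_mod_cast hd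
  have hd2 : (Fintype.card d : ℝ) + 2 ≠ 0 := by positivity
  rw [fourThirdsConst, fourFifthsConst]
  field_simp
  ring

/-- **Novack 2024, Thm. 1: the transverse line follows from the lines `• = I, L`** (op. cit. §2,
Step 2, last paragraph). Granted `novack2024_fourThirds_fourFifths` — for Novack weak Euler
solutions with `u ∈ L³ ∩ C⁰_t L²_x`, `p ∈ L^{3/2}`, `u₀ ∈ L²`, `d ≥ 2`, every `D` with the local
energy balance satisfies the local 4/3 law and the local 4/5 law — the transverse law
`∫₀ᵀ∫ ℓ⁻¹ ⨍ δ_L u |δu_T|²(ℓω) dω ψ → −(4(d−1)/(d(d+2))) D ψ` holds as well: by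
`|δu|² = (δu_L)² + |δu_T|²` on the unit sphere the transverse pairing is the difference of the
two convergent pairings (`integral_mixedFlux_eq_sub`), and
`−4/d + 12/(d(d+2)) = −4(d−1)/(d(d+2))`. [cite: Novack2024, Thm. 1] -/
theorem novack2024_transverseLaw_of_fourThirds_fourFifths
    (h : novack2024_fourThirds_fourFifths (d := d)) : novack2024_transverseLaw (d := d) := by
  intro _ T u₀ u p hd hT hsol hC hu3 hp hu₀ G D hbal ψ hψ
  haveI : Nonempty d := Fintype.card_pos_iff.1 (by omega)
  obtain ⟨h43, h45⟩ := h hd hT hsol hC hu3 hp hu₀ hbal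
  have hu : AEStronglyMeasurable (uncurry u) ((volume.restrict (Ioo 0 T)).prod volume) :=
    aestronglyMeasurable_uncurry_prod_of_stLift_Ioo hsol.1
  have hu3' := lintegral_prod_enorm_pow_three_lt_top hu hu3
  have hψm : AEStronglyMeasurable (uncurry ψ) ((volume.restrict (Ioo 0 T)).prod volume) :=
    hψ.continuous_uncurry.aestronglyMeasurable
  obtain ⟨Cψ, hψb⟩ := hψ.exists_abs_le
  have heq : ∀ ℓ : ℝ, ∫ t in Ioo 0 T, ∫ x, ℓ⁻¹ * mixedFluxSphereAvg (u t) ℓ x * ψ t x =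
      (∫ t in Ioo 0 T, ∫ x, ℓ⁻¹ * energyFluxSphereAvg (u t) ℓ x * ψ t x) -
        ∫ t in Ioo 0 T, ∫ x, ℓ⁻¹ * longitudinalFluxSphereAvg (u t) ℓ x * ψ t x :=
    fun ℓ => integral_mixedFlux_eq_sub hu hu3' hψm hψb ℓ
  rw [tendsto_congr heq, ← neg_fourThirdsConst_mul_sub (by omega) (D ψ)]
  exact (h43 ψ hψ).sub (h45 ψ hψ)

end Literature.Analysis.FluidPDE.Torus
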